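import Literature.Probability.LatticeModels.ScaleFrameDatumDecomp
import Literature.Probability.LatticeModels.ScaleFrameQuasiMultGlue
import HarnessLib

/-!
# Outer exploration data of a scale frame: decomposition and collar tools (proved)

Topic `Literature/Probability/LatticeModels` (trunk `StatMech`, family `crit-ising`); tools for
`ScaleFrameOuterDatum.lean`, the mirror image of `ScaleFrameDatum.lean` (Kesten 1986, proof of
Lemma (23), run with the exploration data of Basu–Sapozhnikov 2017, §2, explored FROM THE OUTSIDE of a
block of a `ScaleFrame`: the probability of an outer datum is comparable across environments deep
inside).

* `ScaleFrame.real_outCross_le_of_noCrossBound` — the frame's RSW clause (ii) read backwards: under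
  `NoCrossBound p q c s s'` an open `⟨E'⟩`-walk (`E' ⊆ E`) from the OUTSIDE `outSet s s'` into the
  inside through the annulus has collar-measure probability `≤ 1 - c` (reverse the walk); this is the
  radial-crossing hypothesis of the boundary-pushing toolkit (A)/(B') of
  `RandomClusterBoundaryPushing.lean` with core `outSet s s'`.
* `mem_explEvent_rimWiredOff_iff` — on lattice configurations the datum event `{𝒞 = U, 𝒟 = R}`
  saturated by the wiring clause OFF the inside (`R` hangs off `U ∖ In`, joined inside `U ∖ In`) is
  the intersection of the DECREASING cylinder "the pairs `S` from `U` to vertices off `U ∪ R` are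
  closed" with an INCREASING event read on the pairs `T` from `U` into `U ∪ R`
  (from `mem_explEvent_rimWired_forward/backward`).
* `outer_scale_facts` — bookkeeping of the scales `b/M⁴ ≤ b/M³ ≤ b/M² < b/M < b < bM` with collar
  width `η ≤ b/M⁴` (the regions themselves are read through `ScaleFrame.mem_outSet_iff_of_lt` of
  `ScaleFrameQuasiMultGlue.lean`).

Everything is proved; no definitions.

## References
* [Kesten1986] H. Kesten, Probab. Theory Related Fields 73 (1986) 369–394, §2, proof of Lemma (23).
* [BasuSapozhnikov2017ECP] D. Basu, A. Sapozhnikov, ECP 22 (2017) no. 26, §2.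
* G. Grimmett, *The Random-Cluster Model*, Springer (2006): Lemma (4.13), (4.14).
-/

noncomputable section

open MeasureTheory Finset SimpleGraph
open Literature.Probability.Percolation (BondConfig openConnIn explEvent
  mem_of_mem_explEvent_of_open_edge openConnIn_mono)

namespace Literature.Probability.LatticeModels

/-! ### The collar input read from the outside -/

/-- **The frame's RSW clause (ii), read from the outside**: under `NoCrossBound p q c s s'`, for every
`E' ⊆ E` the collar measure (genuine frame edges touching the annulus, outside wired) gives an open
`⟨E'⟩`-walk from the OUTSIDE `outSet s s'` to a vertex off `outSet s s' ∪ annSet s s'` (i.e. inside)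
through the annulus probability `≤ 1 - c`: reversed, such a walk is a radial crossing.
[cite: Kesten1986, §2 (eq. (28))] -/
theorem ScaleFrame.real_outCross_le_of_noCrossBound : ∀ {V : Type*} [Fintype V] [DecidableEq V] (F : ScaleFrame V) {p q c s s' : ℝ}, p ∈ Set.Icc (0 : ℝ) 1 → 0 < q → F.NoCrossBound p q c s s' → ∀ {E' : Finset (Sym2 V)}, E' ⊆ F.E → (Literature.Probability.LatticeModels.rcMeasure (SimpleGraph.fromEdgeSet (↑((F.edgesTouching (F.annSet s s')).filter fun e => ¬ e.IsDiag) : Set (Sym2 V))) p q (F.annSet s s')ᶜ).real {ω | ∃ (x y : V) (w : (SimpleGraph.fromEdgeSet (E' : Set (Sym2 V))).Walk x y), x ∈ F.outSet s s' ∧ y ∉ F.outSet s s' ∪ F.annSet s s' ∧ (∀ z ∈ w.support, z = x ∨ z = y ∨ z ∈ F.annSet s s') ∧ ∀ e ∈ w.edges, e ∈ ω} ≤ 1 - c := by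
  intro V _ _ F p q c s s' hp hq hNC E' hE'
  classical
  haveI := isProbabilityMeasure_rcMeasure
    (fromEdgeSet (↑((F.edgesTouching (F.annSet s s')).filter fun e => ¬ e.IsDiag) : Set (Sym2 V)))
    hp hq (F.annSet s s')ᶜ
  refine le_trans (measureReal_mono ?_ (measure_ne_top _ _))
    (F.real_cross_le_of_noCrossBound hp hq hNC hE')
  rintro ω ⟨x, y, w, hx, hy, hs, he⟩
  have hy' : y ∈ F.inSet s := by
    rw [Set.mem_union, not_or, ScaleFrame.mem_outSet, not_not] at hy
    exact hy.1.resolve_right hy.2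
  refine ⟨y, x, w.reverse, hy', F.mem_outSet.1 hx, fun z hz => ?_, fun e he' => ?_⟩
  · rw [Walk.support_reverse, List.mem_reverse] at hz
    rcases hs z hz with h | h | h
    exacts [Or.inr (Or.inl h), Or.inl h, Or.inr (Or.inr h)]
  · rw [Walk.edges_reverse, List.mem_reverse] at he'
    exact he e he'

/-! ### The off-wired datum event as a closed cylinder intersected with an increasing event -/

/-- **The off-wired datum event read on the pairs at the explored set.** Let `In ⊆ U ⊆ In ∪ Blk`,
`R` off `In ∪ Blk`, `S` a set of pairs each joining `U` to a vertex off `U ∪ R` and containing every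
open such pair, `T` a set of pairs containing the open pairs from `U` into `U ∪ R`. Then
`{𝒞 = U, 𝒟 = R} ∩ {R wired off the inside}` holds iff `S` is closed, every vertex of `U` is explored
inside `U` in `ω ∩ T`, and the off-wiring holds in `ω ∩ T` (the last two clauses are increasing and
read on `T`). [cite: BasuSapozhnikov2017ECP, §2, paragraph after eq. (2.3)] -/
theorem mem_explEvent_rimWiredOff_iff {V : Type*} {In Blk U R : Set V} {ω : BondConfig V}
    {S T : Set (Sym2 V)} (hIn : In ⊆ U) (hU : U ⊆ In ∪ Blk) (hR : ∀ r ∈ R, r ∉ In ∪ Blk)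
    (hS₁ : ∀ e ∈ S, ∃ v ∈ e, ∃ w ∈ e, v ∈ U ∧ w ∉ U ∪ R)
    (hS₂ : ∀ v ∈ U, ∀ w ∉ U ∪ R, s(v, w) ∈ ω → s(v, w) ∈ S)
    (hT : ∀ v ∈ U, ∀ w ∈ U ∪ R, v ≠ w → s(v, w) ∈ ω → s(v, w) ∈ T) :
    (ω ∈ explEvent In Blk U R ∧ ∀ r ∈ R, ∀ r₂ ∈ R, ∃ v ∈ U \ In, ∃ v' ∈ U \ In,
        s(v, r) ∈ ω ∧ s(v', r₂) ∈ ω ∧ ω ∈ openConnIn (U \ In) v v') ↔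
      (∀ e ∈ S, e ∉ ω) ∧ (∀ v ∈ U, ∃ u ∈ In, ω ∩ T ∈ openConnIn U u v) ∧
        ∀ r ∈ R, ∀ r₂ ∈ R, ∃ v ∈ U \ In, ∃ v' ∈ U \ In,
          s(v, r) ∈ ω ∩ T ∧ s(v', r₂) ∈ ω ∩ T ∧ ω ∩ T ∈ openConnIn (U \ In) v v' := by
  -- wiring off the inside implies wiring through `U`
  have hoffU : ∀ Z : Set (Sym2 V), (∀ r ∈ R, ∀ r₂ ∈ R, ∃ v ∈ U \ In, ∃ v' ∈ U \ In,
      s(v, r) ∈ Z ∧ s(v', r₂) ∈ Z ∧ Z ∈ openConnIn (U \ In) v v') →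
      ∀ r ∈ R, ∀ r₂ ∈ R, ∃ v ∈ U, ∃ v' ∈ U, s(v, r) ∈ Z ∧ s(v', r₂) ∈ Z ∧ Z ∈ openConnIn U v v' :=
    fun Z h r hr r₂ hr₂ => by
      obtain ⟨v, hv, v', hv', h1, h2, h3⟩ := h r hr r₂ hr₂
      exact ⟨v, hv.1, v', hv'.1, h1, h2, openConnIn_mono Set.sdiff_subset v v' h3⟩
  have hUR : ∀ v ∈ U, ∀ r ∈ R, v ≠ r := fun v hv r hr h => hR r hr (hU (h ▸ hv))
  constructor
  · rintro ⟨hev, hwired⟩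
    refine ⟨fun e heS heω => ?_, (mem_explEvent_rimWired_forward hT hev (hoffU ω hwired)).1,
      fun r hr r₂ hr₂ => ?_⟩
    · obtain ⟨v, hv, w, hw, hvU, hwUR⟩ := hS₁ e heS
      have hne : v ≠ w := fun h => hwUR (Or.inl (h ▸ hvU))
      rw [(Sym2.mem_and_mem_iff hne).1 ⟨hv, hw⟩] at heω
      exact hwUR (Or.inr (mem_of_mem_explEvent_of_open_edge hev hvU heω fun h => hwUR (Or.inl h)))
    · obtain ⟨v, hv, v', hv', hvr, hv'r, hvv'⟩ := hwired r hr r₂ hr₂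
      exact ⟨v, hv, v', hv', ⟨hvr, hT v hv.1 r (Or.inr hr) (hUR v hv.1 r hr) hvr⟩,
        ⟨hv'r, hT v' hv'.1 r₂ (Or.inr hr₂) (hUR v' hv'.1 r₂ hr₂) hv'r⟩,
        openConnIn_of_agree_ne hvv' fun x hx y hy hxy h => ⟨h, hT x hx.1 y (Or.inl hy.1) hxy h⟩⟩
  · rintro ⟨hDω, h1, h2⟩
    refine ⟨(mem_explEvent_rimWired_backward hIn hU hR hS₂ hDω h1 (hoffU _ h2)).1,
      fun r hr r₂ hr₂ => ?_⟩
    obtain ⟨v, hv, v', hv', hvr, hv'r, hvv'⟩ := h2 r hr r₂ hr₂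
    exact ⟨v, hv, v', hv', hvr.1, hv'r.1, openConnIn_of_agree_ne hvv' fun x _ y _ _ hxy => hxy.1⟩

/-! ### Scales -/

/-- **Scale bookkeeping** for the outer datum: with `b > 0`, `M ≥ 2` and collar width `η ≤ b/M⁴`,
`b/M² + η ≤ b/M`, `b/M + η ≤ b`, `b/M⁴ ≤ b/M³ ≤ b/M² < b/M < b < bM`. [folklore] -/
theorem outer_scale_facts {b M η : ℝ} (hb : 0 < b) (hM : 2 ≤ M) (hη : η ≤ b / M ^ 4) :
    b / M ^ 2 + η ≤ b / M ∧ b / M + η ≤ b ∧ b / M ^ 4 ≤ b / M ^ 3 ∧ b / M ^ 3 ≤ b / M ^ 2 ∧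
      b / M ^ 2 < b / M ∧ b / M < b ∧ b < b * M := by
  have hM0 : (0 : ℝ) < M := by linarith
  obtain ⟨t, ht0, e4⟩ : ∃ t : ℝ, 0 < t ∧ b / M ^ 4 = t := ⟨_, div_pos hb (pow_pos hM0 4), rfl⟩
  have e0 : b = t * M ^ 4 := by rw [← e4, div_mul_cancel₀ b (pow_ne_zero 4 hM0.ne')]
  have e1 : b / M = t * M ^ 3 := by
    rw [e0, show t * M ^ 4 = t * M ^ 3 * M by ring, mul_div_cancel_right₀ _ hM0.ne']
  have e2 : b / M ^ 2 = t * M ^ 2 := by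
    rw [e0, show t * M ^ 4 = t * M ^ 2 * M ^ 2 by ring, mul_div_cancel_right₀ _ (pow_ne_zero 2 hM0.ne')]
  have e3 : b / M ^ 3 = t * M := by
    rw [e0, show t * M ^ 4 = t * M * M ^ 3 by ring, mul_div_cancel_right₀ _ (pow_ne_zero 3 hM0.ne')]
  have e5 : b * M = t * M ^ 5 := by rw [e0]; ring
  have st0 : t + t ≤ t * M := by
    have h := scale_step ht0.le hM 0; rwa [pow_zero, mul_one, zero_add, pow_one] at h
  have st1 : t * M + t ≤ t * M ^ 2 := by have h := scale_step ht0.le hM 1; rwa [pow_one] at h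
  have st2 : t * M ^ 2 + t ≤ t * M ^ 3 := scale_step ht0.le hM 2
  have st3 : t * M ^ 3 + t ≤ t * M ^ 4 := scale_step ht0.le hM 3
  have st4 : t * M ^ 4 + t ≤ t * M ^ 5 := scale_step ht0.le hM 4
  have hηt : η ≤ t := e4 ▸ hη
  refine ⟨?_, ?_, ?_, ?_, ?_, ?_, ?_⟩ <;> linarith

end Literature.Probability.LatticeModels

end
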